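import Summits.Parity.GeneralizedHardyLittlewood.Theorems.LeeYangFibresFibrationLemmaFibreSums
import Summits.Parity.GeneralizedHardyLittlewood.Theorems.LeeYangFibresFibrationLemmaLift
import Summits.Parity.GeneralizedHardyLittlewood.Theorems.LeeYangFibresFibrationLemmaAveraging
import HarnessLib

/-!
# Fibration lemma (`DimOne → GeneralizedHardyLittlewood`): the final glue

Support file for the statement item `FibrationLemma : DimOne → GeneralizedHardyLittlewood`
(stmt-Parity-0822, shared; here for route `LeeYangFibres`, whose `Assembly` (stmt-Parity-14612)
composes through it). Green–Tao's fibration remark (2010, §1, after Conj. 1.2: "holding `d − 1` of the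
variables fixed and summing in the remaining one") is formalised in the `LeeYangFibresFibrationLemma*`
files as two halves over the positive part `K⁺ = K ∩ Ψ⁻¹((ℝ₊)ᵗ)` of the body:

* LEFT (`FibrationFibreSums.fibreSums_estimate`, proved): under `DimOne`,
  `∑_{n ∈ K ∩ ℤ^{d+1}} ∏ᵢ Λ(ψᵢ(n)) = ∑_{w good} β_∞(Φ_w, K_w) 𝔖(Φ_w) + o(N^{d+1})`;
* RIGHT (the averaging of the fibre main terms, parts 4–10 of the fibration files, stated here as
  the hypothesis `hAvg` on the standing data `FibreSetting`):
  `∑_{w good} ℓ(w) 𝔖(Φ_w) = vol(K⁺) 𝔖(Ψ) + o(N^{d+1})`.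

This file supplies the deterministic end of the argument:

* `posBody_posBody`, `archFactor_posBody` — `K⁺⁺ = K⁺`, so `β_∞(Ψ, K⁺) = β_∞(Ψ, K) = vol(K⁺)`; with the
  tree's `vonMangoldtSum_posBody_zero` (`Λ` vanishes at non-positive arguments) both sides of the
  conjecture are unchanged under `K ↦ K⁺`, on which every form is positive (`FibreSetting.pos`);
* `restricted_of_fibreAveraging` — LEFT + RIGHT give Conjecture 1.2 for every `(d+1)`-dimensional
  non-degenerate system with non-zero last coefficients (triangle inequality on `K⁺`);
* `generalizedHardyLittlewood_of_fibreAveraging` — with the lift `FibrationLift.generalizedHardyLittlewood_of_lastCoeff`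
  (reduction of an arbitrary system to non-zero last coefficients), RIGHT and `DimOne` imply
  `GeneralizedHardyLittlewood` in full. The fibration lemma of every `d = 1` route is then the
  one-liner `fun hDim => generalizedHardyLittlewood_of_fibreAveraging avg hDim` once RIGHT (`avg`) lands.

References: B. Green, T. Tao, *Linear equations in primes*, Ann. of Math. 171 (2010), §1 (Conj. 1.2 and
the remark following it, (1.4)), §4 ("Elimination of the archimedean factor") [GreenTao2010].
No named facts are used; `DimOne` enters as an explicit hypothesis in unfolded form.
-/

noncomputable section

open Finset MeasureTheory

namespace Summit.Parity.GeneralizedHardyLittlewood.Theorems.FibrationGlue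

open Literature.NumberTheory.Sieve
open Summit.Parity.GeneralizedHardyLittlewood.Theorems.FibrationFibreSums
  (fibreSums_estimate natAbs_const_le_of_affLinSize_le)
open Summit.Parity.GeneralizedHardyLittlewood.Theorems.FibrationLift
  (generalizedHardyLittlewood_of_lastCoeff)

variable {d t : ℕ}

/-! ### The positive part of the body -/

/-- `K⁺⁺ = K⁺`: taking the positive part of a body is idempotent. [folklore] -/
theorem posBody_posBody (Ψ : Fin t → AffLinForm d) (K : Set (Fin d → ℝ)) :
    posBody Ψ 0 (posBody Ψ 0 K) = posBody Ψ 0 K := by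
  ext x
  simp only [posBody, Set.mem_inter_iff, Set.mem_setOf_eq]
  tauto

/-- `β_∞(Ψ, K⁺) = β_∞(Ψ, K)` ("`β_∞` is simply the volume of `K`" after intersecting with
`Ψ⁻¹((ℝ⁺)ᵗ)`). [cite: GreenTao2010, §4 (Elimination of the archimedean factor)] -/
theorem archFactor_posBody (Ψ : Fin t → AffLinForm d) (K : Set (Fin d → ℝ)) :
    archFactor Ψ (posBody Ψ 0 K) = archFactor Ψ K := by
  rw [archFactor_eq_volume_posBody, archFactor_eq_volume_posBody, posBody_posBody]

/-! ### LEFT + RIGHT: the conjecture for systems with non-zero last coefficients -/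

/-- **The two halves of the fibration argument combined.** Assume `DimOne` (hypothesis `hDim`,
unfolded) and the averaging of the fibre main terms (hypothesis `hAvg`: for the standing data
`S = (Ψ, L, N, K)` of the fibre argument — `Ψ` non-degenerate on `ℤ^{d+1}` with coefficients `≤ L`,
constants `≤ L N`, non-zero last coefficients, `K ⊆ [-N, N]^{d+1}` convex with `Ψ > 0` on `K` —
`|∑_{w good} ℓ(w) 𝔖(Φ_w) − vol(K) 𝔖(Ψ)| ≤ ε N^{d+1}` once `N ≥ N₀(d, t, L, ε)`). Then for `d, t ≥ 1`,
uniformly over non-degenerate `Ψ` on `ℤ^{d+1}` with `‖Ψ‖_N ≤ L` and all `ψ̇ᵢ(e_{d+1}) ≠ 0` and convex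
`K ⊆ [-N, N]^{d+1}`: `|∑_{K ∩ ℤ^{d+1}} ∏ᵢ Λ(ψᵢ(n)) − β_∞ ∏_p β_p| ≤ ε N^{d+1}` for `N ≥ N₀`. Proof: pass to
`K⁺` (both sides unchanged), apply LEFT (`fibreSums_estimate`) and RIGHT there, triangle inequality.
[cite: GreenTao2010, §1 (remark after Conj. 1.2)] -/
theorem restricted_of_fibreAveraging
    (hAvg : ∀ (d t L : ℕ), 1 ≤ d → 1 ≤ t → ∀ ε : ℝ, 0 < ε → ∃ N₀ : ℕ, ∀ S : FibreSetting d t,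
        S.L = L → N₀ ≤ S.N →
          |∑ w ∈ goodSet S.Ψ S.N, S.ell w * singularProduct (fibreSystem S.Ψ w) -
              (volume S.K).toReal * singularProduct S.Ψ| ≤ ε * (S.N : ℝ) ^ (d + 1))
    (hDim : ∀ (t L : ℕ), 1 ≤ t → ∀ ε : ℝ, 0 < ε → ∃ N₀ : ℕ, ∀ N : ℕ, N₀ ≤ N →
      ∀ Φ : Fin t → AffLinForm 1, IsNondegenerateSystem Φ → affLinSize Φ N ≤ L →
        ∀ K : Set (Fin 1 → ℝ), Convex ℝ K → K ⊆ realBox 1 N →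
          |vonMangoldtSum Φ K N - archFactor Φ K * singularProduct Φ| ≤ ε * (N : ℝ))
    (d t L : ℕ) (hd : 1 ≤ d) (ht : 1 ≤ t) (ε : ℝ) (hε : 0 < ε) :
    ∃ N₀ : ℕ, ∀ N : ℕ, N₀ ≤ N →
      ∀ Ψ : Fin t → AffLinForm (d + 1), IsNondegenerateSystem Ψ →
        (∀ i, (Ψ i).coeff (Fin.last d) ≠ 0) → affLinSize Ψ N ≤ L →
          ∀ K : Set (Fin (d + 1) → ℝ), Convex ℝ K → K ⊆ realBox (d + 1) N →
            |vonMangoldtSum Ψ K N - archFactor Ψ K * singularProduct Ψ| ≤ ε * (N : ℝ) ^ (d + 1) := by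
  obtain ⟨N₁, hN₁⟩ := fibreSums_estimate hDim d t L hd ht (ε / 2) (half_pos hε)
  obtain ⟨N₂, hN₂⟩ := hAvg d t L hd ht (ε / 2) (half_pos hε)
  refine ⟨max (max N₁ N₂) 1, fun N hN Ψ hΨ hlast hΨL K hK hKN => ?_⟩
  have hN1 : 1 ≤ N := le_of_max_le_right hN
  have hNN₁ : N₁ ≤ N := (le_max_left _ _).trans (le_of_max_le_left hN)
  have hNN₂ : N₂ ≤ N := (le_max_right _ _).trans (le_of_max_le_left hN)
  have hlast' : ∀ i, lastCoeff (Ψ i) ≠ 0 := hlast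
  -- the positive part of the body
  set K' : Set (Fin (d + 1) → ℝ) := posBody Ψ 0 K with hK'
  have hK'conv : Convex ℝ K' := convex_posBody Ψ 0 hK
  have hK'sub : K' ⊆ realBox (d + 1) N := (posBody_subset Ψ 0 K).trans hKN
  -- LEFT on `K'`
  have hleft := hN₁ N hNN₁ Ψ hΨ hlast' hΨL K' hK'conv hK'sub
  -- RIGHT on the standing data over `K'`
  let S : FibreSetting d t :=
    { Ψ := Ψ, L := L, N := N, K := K', nondeg := hΨ, one_le_d := hd, one_le_t := ht,
      coeff_le := fun i j => natAbs_coeff_le_of_affLinSize_le hΨL i j,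
      const_le := fun i => natAbs_const_le_of_affLinSize_le hN1 hΨL i,
      lastCoeff_ne := hlast', one_le_N := hN1, convex := hK'conv, subset := hK'sub,
      pos := fun x hx i => realEval_gt_of_mem_posBody hx i }
  have hright :
      |∑ w ∈ goodSet Ψ N, archFactor (fibreSystem Ψ w) (fibreBody K' (realPoint w)) *
            singularProduct (fibreSystem Ψ w) -
          (volume K').toReal * singularProduct Ψ| ≤ ε / 2 * (N : ℝ) ^ (d + 1) :=
    hN₂ S rfl hNN₂
  -- both sides of the conjecture only see `K'`
  rw [← vonMangoldtSum_posBody_zero Ψ K N, archFactor_eq_volume_posBody Ψ K]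
  calc |vonMangoldtSum Ψ K' N - (volume K').toReal * singularProduct Ψ|
      ≤ |vonMangoldtSum Ψ K' N -
            ∑ w ∈ goodSet Ψ N, archFactor (fibreSystem Ψ w) (fibreBody K' (realPoint w)) *
              singularProduct (fibreSystem Ψ w)| +
          |∑ w ∈ goodSet Ψ N, archFactor (fibreSystem Ψ w) (fibreBody K' (realPoint w)) *
              singularProduct (fibreSystem Ψ w) -
            (volume K').toReal * singularProduct Ψ| := abs_sub_le _ _ _
    _ ≤ ε / 2 * (N : ℝ) ^ (d + 1) + ε / 2 * (N : ℝ) ^ (d + 1) := add_le_add hleft hright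
    _ = ε * (N : ℝ) ^ (d + 1) := by ring

/-- **The fibration lemma modulo the averaging of the fibre main terms.** If the fibre main terms
average to the main term (`hAvg`, as in `restricted_of_fibreAveraging`), then the one-dimensional
conjecture `DimOne` (hypothesis `hDim`, unfolded, common to all `d = 1` routes) implies Green–Tao's
Conjecture 1.2 in every dimension: `restricted_of_fibreAveraging` gives it for systems with non-zero
last coefficients in dimensions `≥ 2`, and `FibrationLift.generalizedHardyLittlewood_of_lastCoeff`
lifts an arbitrary system to that case. [cite: GreenTao2010, §1 (remark after Conj. 1.2)] -/
theorem generalizedHardyLittlewood_of_fibreAveraging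
    (hAvg : ∀ (d t L : ℕ), 1 ≤ d → 1 ≤ t → ∀ ε : ℝ, 0 < ε → ∃ N₀ : ℕ, ∀ S : FibreSetting d t,
        S.L = L → N₀ ≤ S.N →
          |∑ w ∈ goodSet S.Ψ S.N, S.ell w * singularProduct (fibreSystem S.Ψ w) -
              (volume S.K).toReal * singularProduct S.Ψ| ≤ ε * (S.N : ℝ) ^ (d + 1))
    (hDim : ∀ (t L : ℕ), 1 ≤ t → ∀ ε : ℝ, 0 < ε → ∃ N₀ : ℕ, ∀ N : ℕ, N₀ ≤ N →
      ∀ Φ : Fin t → AffLinForm 1, IsNondegenerateSystem Φ → affLinSize Φ N ≤ L →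
        ∀ K : Set (Fin 1 → ℝ), Convex ℝ K → K ⊆ realBox 1 N →
          |vonMangoldtSum Φ K N - archFactor Φ K * singularProduct Φ| ≤ ε * (N : ℝ)) :
    GeneralizedHardyLittlewood :=
  generalizedHardyLittlewood_of_lastCoeff fun d t L hd ht ε hε =>
    restricted_of_fibreAveraging hAvg hDim d t L hd ht ε hε

end Summit.Parity.GeneralizedHardyLittlewood.Theorems.FibrationGlue
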